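import Literature.GroupTheory.CombinatorialGroupTheory.RandomSclFreeGroupUpperTail
import Literature.GroupTheory.CombinatorialGroupTheory.RandomSclFreeGroupTripodEvents
import HarnessLib

/-!
# Random rigidity of scl (Calegari–Walker 2013): proofs, part 21 — the sharp upper tail
(constant 1/6), asymptotic lemmas

D. Calegari, A. Walker, *Random rigidity in the free group*, Geom. Topol. 17 (2013)
[CalegariWalker2013], Prop. 4.2: `scl(v) log n / n ≤ log(2k−1)/6 + ε` with probability
`1 − O(C^{−n^c})`. The tripod fatgraph (`scl_le_of_subwordCounts`) gives, for a word whose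
subwords of lengths `2h + 2` and `h + 2` are equidistributed with relative accuracy `η₁`,
`scl ≤ n/(12h) + 3 η₁ n + 2h + 3`; with `h = ⌊(1/2 − θ) log n / log(2k−1)⌋` and
`η₁ = O(n^{−θ/2})` this is `(log(2k−1)/6 + ε) n / log n`. This file collects the real-analysis
lemmas of that bookkeeping.

* **`scl_ratio_le`** — the algebra: from `4N' s + (3h−1) Tlow ≤ N' n + 2 + (h+1) Uup` to
  `s ≤ n/(12h) + 3 η₁ n + 2h + 3`.
* **`threshold_sharp_le`** — `log n/(12h) ≤ log(2k−1)/6 + ε/3` for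
  `h ≥ (1/2 − θ) log n/log q − 1`, `θ ≤ ε/(4 log q)`.
* **`eventually_windowLength_half`** — the window parameter `h = ⌊L log n / log q⌋`,
  `1/4 ≤ L ≤ 1/2`.
-/

noncomputable section

open Filter Topology

namespace Literature.GroupTheory.CombinatorialGroupTheory

section SharpUpperLemmas

/-- `(1 − 4η)(1 + η)² ≤ (1 − η)²` for `η ≥ 0`. [folklore] -/
theorem one_sub_four_mul_ineq {η : ℝ} (hη : 0 ≤ η) :
    (1 - 4 * η) * ((1 + η) * (1 + η)) ≤ (1 - η) * (1 - η) := by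
  nlinarith [sq_nonneg η, mul_nonneg hη (sq_nonneg η)]

/-- The polynomial inequality behind the tripod term. [folklore] -/
theorem tripodTerm_poly_ineq {h n η : ℝ} (hh : 1 ≤ h) (hn : 3 * h + 3 ≤ n) (hη : 0 ≤ η) :
    (3 * h - 1) * n - 12 * h * η * n - 12 * h * (h + 1) ≤
      (3 * h - 1) * (n - 3 * h - 3) * (1 - 4 * η) := by
  have e : (3 * h - 1) * (n - 3 * h - 3) * (1 - 4 * η) -
      ((3 * h - 1) * n - 12 * h * η * n - 12 * h * (h + 1)) =
      3 * h ^ 2 + 6 * h + 3 + 4 * η * n + 4 * η * ((3 * h - 1) * (3 * h + 3)) := by ring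
  have hn0 : 0 ≤ n := by linarith
  have h1 : 0 ≤ (3 * h - 1) * (3 * h + 3) := mul_nonneg (by linarith) (by linarith)
  have h2 : 0 ≤ 4 * η * n := by positivity
  have h3 : 0 ≤ 4 * η * ((3 * h - 1) * (3 * h + 3)) := by positivity
  nlinarith [e, h1, h2, h3]

/-- **The algebra of the tripod bound.** Let `h ≥ 1`, `qq ≥ 1`, accuracy `0 ≤ η₁ ≤ 1/2`, means
`A, B > 0`, and `1 ≤ Amax ≤ (1+η₁)A`, `A ≤ 2 Amax`, `(1−η₁)A ≤ Amin`, `0 ≤ D ≤ 2η₁A`,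
`1 ≤ Bmax ≤ (1+η₁)B`, `(1−η₁)B ≤ BminH`, `n − 3h − 3 ≤ n' ≤ n`, `3h + 3 ≤ n`. If
`s` satisfies `4 N' s + (3h−1) n' (qq BminH)(qq Amin) ≤ N' n + 2 + (h+1) 3qq (D n' qq Bmax +
Amax 2h qq Bmax)` with `N' = 3h (qq Bmax)(qq Amax)`, then `s ≤ n/(12h) + 3η₁ n + 2h + 3`.
[cite: CalegariWalker2013, Prop. 4.2 (proof)] -/
theorem scl_ratio_le {n h qq A B η₁ Amax Amin Bmax BminH D s n' : ℝ} (hh : 1 ≤ h)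
    (hqq : 1 ≤ qq) (hA : 0 < A) (hB : 0 < B) (hη0 : 0 ≤ η₁) (hη : η₁ ≤ 1 / 2)
    (hAmax : Amax ≤ (1 + η₁) * A) (hAmin : (1 - η₁) * A ≤ Amin) (hA2 : A ≤ 2 * Amax)
    (hA1 : 1 ≤ Amax) (hD0 : 0 ≤ D) (hD : D ≤ 2 * η₁ * A)
    (hBmax : Bmax ≤ (1 + η₁) * B) (hBmin : (1 - η₁) * B ≤ BminH)
    (hB1 : 1 ≤ Bmax) (hn3 : 3 * h + 3 ≤ n) (hn'1 : n - 3 * h - 3 ≤ n') (hn'2 : n' ≤ n)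
    (hmain : 4 * (3 * h * ((qq * Bmax) * (qq * Amax))) * s +
      (3 * h - 1) * (n' * (qq * BminH) * (qq * Amin)) ≤
      (3 * h * ((qq * Bmax) * (qq * Amax))) * n + 2 +
        (h + 1) * (3 * qq * (D * (n' * (qq * Bmax)) + Amax * (2 * h * (qq * Bmax))))) :
    s ≤ n / (12 * h) + 3 * η₁ * n + 2 * h + 3 := by
  -- positivity
  have h1η : 0 ≤ 1 - η₁ := by linarith
  have hAmin0 : 0 < Amin := lt_of_lt_of_le (mul_pos (by linarith) hA) hAmin
  have hAmax0 : 0 < Amax := by linarith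
  have hBmin0 : 0 < BminH := lt_of_lt_of_le (mul_pos (by linarith) hB) hBmin
  have hBmax0 : 0 < Bmax := by linarith
  have hqq0 : 0 < qq := by linarith
  have hh0 : 0 < h := by linarith
  have hn0 : 0 ≤ n := by linarith
  have hn'0 : 0 ≤ n' := by linarith
  set X := qq * Bmax with hX
  set Y := qq * Amax with hY
  have hX1 : 1 ≤ X := by
    rw [hX]; calc (1 : ℝ) = 1 * 1 := by ring
      _ ≤ qq * Bmax := mul_le_mul hqq hB1 zero_le_one hqq0.le
  have hY1 : 1 ≤ Y := by
    rw [hY]; calc (1 : ℝ) = 1 * 1 := by ring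
      _ ≤ qq * Amax := mul_le_mul hqq hA1 zero_le_one hqq0.le
  have hX0 : 0 < X := by linarith
  have hY0 : 0 < Y := by linarith
  have hXY1 : 1 ≤ X * Y := by
    calc (1 : ℝ) = 1 * 1 := by ring
      _ ≤ X * Y := mul_le_mul hX1 hY1 zero_le_one hX0.le
  have hXY0 : 0 < X * Y := by positivity
  set N4 := 4 * (3 * h * (X * Y)) with hN4
  have hN4pos : 0 < N4 := by rw [hN4]; positivity
  -- (C) the constant term: `2 ≤ N4`
  have hC : (2 : ℝ) ≤ N4 * 1 := by
    rw [hN4, mul_one]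
    have : (1 : ℝ) ≤ h * (X * Y) := by
      calc (1 : ℝ) = 1 * 1 := by ring
        _ ≤ h * (X * Y) := mul_le_mul hh hXY1 zero_le_one hh0.le
    linarith
  -- (A) the unglued-prong term
  have hU : (h + 1) * (3 * qq * (D * (n' * X) + Amax * (2 * h * X))) ≤
      N4 * (2 * η₁ * n + (h + 1) / 2) := by
    -- `(h+1) D n' ≤ 8 h η₁ n Amax`
    have h1 : D * n' ≤ 2 * η₁ * A * n := by
      calc D * n' ≤ 2 * η₁ * A * n' := mul_le_mul_of_nonneg_right hD hn'0
        _ ≤ 2 * η₁ * A * n := mul_le_mul_of_nonneg_left hn'2 (by positivity)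
    have h2 : 2 * η₁ * A * n ≤ 2 * η₁ * (2 * Amax) * n :=
      mul_le_mul_of_nonneg_right (mul_le_mul_of_nonneg_left hA2 (by positivity)) hn0
    have h3 : (h + 1) * (D * n') ≤ 8 * h * η₁ * n * Amax := by
      have : (h + 1) * (D * n') ≤ (2 * h) * (2 * η₁ * (2 * Amax) * n) :=
        mul_le_mul (by linarith) (h1.trans h2) (by positivity) (by positivity)
      linarith
    have e : N4 * (2 * η₁ * n + (h + 1) / 2) =
        3 * qq * X * (8 * h * η₁ * n * Amax + 2 * h * (h + 1) * Amax) := by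
      rw [hN4, hY]; ring
    rw [e]
    have e2 : (h + 1) * (3 * qq * (D * (n' * X) + Amax * (2 * h * X))) =
        3 * qq * X * ((h + 1) * (D * n') + 2 * h * (h + 1) * Amax) := by ring
    rw [e2]
    exact mul_le_mul_of_nonneg_left (by linarith) (by positivity)
  -- (B) the tripod term, and the conclusion
  have hfinal : N4 * s ≤ N4 * (n / (12 * h) + 3 * η₁ * n + 2 * h + 3) := by
    by_cases hη4 : η₁ ≤ 1 / 4
    · -- `BminH Amin ≥ (1 - 4η₁) Bmax Amax`
      have hprod : (1 - 4 * η₁) * (Bmax * Amax) ≤ BminH * Amin := by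
        have h1 : ((1 - η₁) * B) * ((1 - η₁) * A) ≤ BminH * Amin :=
          mul_le_mul hBmin hAmin (mul_nonneg h1η hA.le) hBmin0.le
        have h2 : Bmax * Amax ≤ ((1 + η₁) * B) * ((1 + η₁) * A) :=
          mul_le_mul hBmax hAmax hAmax0.le (by positivity)
        have h3 := one_sub_four_mul_ineq hη0
        have hAB : 0 ≤ A * B := by positivity
        have h14 : 0 ≤ 1 - 4 * η₁ := by linarith
        calc (1 - 4 * η₁) * (Bmax * Amax) ≤ (1 - 4 * η₁) * (((1 + η₁) * B) * ((1 + η₁) * A)) :=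
              mul_le_mul_of_nonneg_left h2 h14
          _ = ((1 - 4 * η₁) * ((1 + η₁) * (1 + η₁))) * (A * B) := by ring
          _ ≤ ((1 - η₁) * (1 - η₁)) * (A * B) := mul_le_mul_of_nonneg_right h3 hAB
          _ = ((1 - η₁) * B) * ((1 - η₁) * A) := by ring
          _ ≤ BminH * Amin := h1
      have hT : N4 * ((3 * h - 1) * n / (12 * h) - η₁ * n - (h + 1)) ≤
          (3 * h - 1) * (n' * (qq * BminH) * (qq * Amin)) := by
        have h14 : 0 ≤ 1 - 4 * η₁ := by linarith
        have h3h : 0 ≤ 3 * h - 1 := by linarith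
        -- `T ≥ (3h-1) n' (1-4η₁) XY ≥ (3h-1)(n-3h-3)(1-4η₁) XY`
        have h2 : (1 - 4 * η₁) * (X * Y) ≤ qq * qq * (BminH * Amin) := by
          calc (1 - 4 * η₁) * (X * Y) = qq * qq * ((1 - 4 * η₁) * (Bmax * Amax)) := by
                rw [hX, hY]; ring
            _ ≤ qq * qq * (BminH * Amin) := mul_le_mul_of_nonneg_left hprod (by positivity)
        have h1 : (3 * h - 1) * (n - 3 * h - 3) * ((1 - 4 * η₁) * (X * Y)) ≤
            (3 * h - 1) * (n' * (qq * BminH) * (qq * Amin)) := by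
          have e : (3 * h - 1) * (n' * (qq * BminH) * (qq * Amin)) =
              (3 * h - 1) * n' * (qq * qq * (BminH * Amin)) := by ring
          rw [e]
          have hpos : 0 ≤ (1 - 4 * η₁) * (X * Y) := mul_nonneg h14 hXY0.le
          calc (3 * h - 1) * (n - 3 * h - 3) * ((1 - 4 * η₁) * (X * Y))
              ≤ (3 * h - 1) * n' * ((1 - 4 * η₁) * (X * Y)) :=
                mul_le_mul_of_nonneg_right (mul_le_mul_of_nonneg_left hn'1 h3h) hpos
            _ ≤ (3 * h - 1) * n' * (qq * qq * (BminH * Amin)) :=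
                mul_le_mul_of_nonneg_left h2 (mul_nonneg h3h hn'0)
        refine le_trans ?_ h1
        have e1 : N4 * ((3 * h - 1) * n / (12 * h) - η₁ * n - (h + 1)) =
            X * Y * ((3 * h - 1) * n - 12 * h * η₁ * n - 12 * h * (h + 1)) := by
          rw [hN4]; field_simp; ring
        rw [e1]
        have e2 : (3 * h - 1) * (n - 3 * h - 3) * ((1 - 4 * η₁) * (X * Y)) =
            X * Y * ((3 * h - 1) * (n - 3 * h - 3) * (1 - 4 * η₁)) := by ring
        rw [e2]
        exact mul_le_mul_of_nonneg_left (tripodTerm_poly_ineq hh hn3 hη0) hXY0.le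
      -- combine
      have hsum : N4 * s ≤ (3 * h * (X * Y)) * n + N4 * 1 + N4 * (2 * η₁ * n + (h + 1) / 2) -
          N4 * ((3 * h - 1) * n / (12 * h) - η₁ * n - (h + 1)) := by linarith
      have e : (3 * h * (X * Y)) * n + N4 * 1 + N4 * (2 * η₁ * n + (h + 1) / 2) -
          N4 * ((3 * h - 1) * n / (12 * h) - η₁ * n - (h + 1)) =
          N4 * (n / (12 * h) + 3 * η₁ * n + 3 / 2 * h + 5 / 2) := by
        rw [hN4]; field_simp; ring
      rw [e] at hsum
      refine hsum.trans (mul_le_mul_of_nonneg_left ?_ hN4pos.le)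
      linarith
    · -- `η₁ > 1/4`: drop the tripod term
      rw [not_le] at hη4
      have hT0 : 0 ≤ (3 * h - 1) * (n' * (qq * BminH) * (qq * Amin)) :=
        mul_nonneg (by linarith) (by positivity)
      have hsum : N4 * s ≤ (3 * h * (X * Y)) * n + N4 * 1 + N4 * (2 * η₁ * n + (h + 1) / 2) := by
        linarith
      have e : (3 * h * (X * Y)) * n + N4 * 1 + N4 * (2 * η₁ * n + (h + 1) / 2) =
          N4 * (n / 4 + 1 + 2 * η₁ * n + (h + 1) / 2) := by
        rw [hN4]; ring
      rw [e] at hsum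
      refine hsum.trans (mul_le_mul_of_nonneg_left ?_ hN4pos.le)
      have h1 : n / 4 ≤ η₁ * n := by
        have : (1 / 4 : ℝ) * n ≤ η₁ * n := mul_le_mul_of_nonneg_right hη4.le hn0
        linarith
      have h2 : 0 ≤ n / (12 * h) := by positivity
      linarith
  exact le_of_mul_le_mul_left hfinal hN4pos

/-- **The threshold.** If `h ≥ (1/2 − θ) log n / log q − 1`, `log q / log n ≤ θ ≤ 1/8`,
`θ ≤ ε / (4 log q)`, `1 < log q`: `log n / (12 h) ≤ log q / 6 + ε / 3`.
[cite: CalegariWalker2013, Lemma 3.7 and Prop. 4.2] -/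
theorem threshold_sharp_le {n h q θ ε : ℝ} (hlq : 1 < Real.log q) (hlogn : 0 < Real.log n)
    (hθ0 : 0 < θ) (hθ8 : θ ≤ 1 / 8) (hθε : θ ≤ ε / (4 * Real.log q)) (hε : 0 < ε)
    (hqn : Real.log q / Real.log n ≤ θ)
    (hh : (1 / 2 - θ) * Real.log n / Real.log q - 1 ≤ h) :
    Real.log n / (12 * h) ≤ Real.log q / 6 + ε / 3 := by
  have hlq0 : 0 < Real.log q := by linarith
  set m := Real.log n / Real.log q with hm
  have hm0 : 0 < m := by rw [hm]; positivity
  -- `1/m ≤ θ`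
  have hminv : 1 / m ≤ θ := by
    rw [hm, one_div_div]; exact hqn
  have hm8 : 8 ≤ m := by
    have h1 : 1 / m ≤ 1 / 8 := hminv.trans hθ8
    rwa [one_div_le_one_div hm0 (by norm_num)] at h1
  -- `12 h ≥ m (6 - 24 θ) ≥ 3m > 0`
  have hh' : m * (6 - 24 * θ) ≤ 12 * h := by
    have e : (1 / 2 - θ) * Real.log n / Real.log q = (1 / 2 - θ) * m := by rw [hm]; ring
    rw [e] at hh
    -- `12 ≤ 12 θ m`
    have h12 : (12 : ℝ) ≤ 12 * θ * m := by
      have : 1 ≤ θ * m := by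
        rw [one_div_le hm0 hθ0] at hminv
        rw [one_div] at hminv
        have := (inv_le_iff_one_le_mul₀ hθ0).mp hminv
        linarith
      linarith
    nlinarith
  have hden : 0 < m * (6 - 24 * θ) := by nlinarith
  have h12h : 0 < 12 * h := lt_of_lt_of_le hden hh'
  calc Real.log n / (12 * h) ≤ Real.log n / (m * (6 - 24 * θ)) :=
        div_le_div_of_nonneg_left hlogn.le hden hh'
    _ = Real.log q / (6 - 24 * θ) := by
        rw [hm]; field_simp
    _ ≤ Real.log q / 6 + ε / 3 := by
        rw [div_le_iff₀ (by linarith)]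
        -- `log q ≤ (log q/6 + ε/3)(6 - 24θ)` iff `24 θ log q /6·... `: `4 θ log q ≤ ε (6-24θ)/3 ·`
        have h1 : θ * (4 * Real.log q) ≤ ε := by rwa [le_div_iff₀ (by positivity)] at hθε
        nlinarith

/-- **The window-length parameter, `L ≤ 1/2`.** For `q ≥ 3` and `1/4 ≤ L ≤ 1/2`, with
`h(n) = ⌊L log n / log q⌋`: eventually `1 ≤ h`, `L log n / log q − 1 ≤ h ≤ L log n / log q`,
`h + 1 ≤ 3 log n`, `1 ≤ log n`, `n^L ≤ q^{h + 1}` and `q^h ≤ n^L`. [folklore] -/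
theorem eventually_windowLength_half {q L : ℝ} (hq : 3 ≤ q) (hL1 : 1 / 4 ≤ L) (hL2 : L ≤ 1 / 2) :
    ∀ᶠ n : ℕ in atTop, 1 ≤ ⌊L * Real.log n / Real.log q⌋₊ ∧
      L * Real.log n / Real.log q - 1 ≤ (⌊L * Real.log n / Real.log q⌋₊ : ℝ) ∧
      (⌊L * Real.log n / Real.log q⌋₊ : ℝ) ≤ L * Real.log n / Real.log q ∧
      (⌊L * Real.log n / Real.log q⌋₊ : ℝ) + 1 ≤ 3 * Real.log n ∧
      1 ≤ Real.log n ∧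
      (n : ℝ) ^ L ≤ q ^ (⌊L * Real.log n / Real.log q⌋₊ + 1) ∧
      q ^ ⌊L * Real.log n / Real.log q⌋₊ ≤ (n : ℝ) ^ L := by
  have hlq : 1 < Real.log q := one_lt_log_three.trans_le (Real.log_le_log (by norm_num) hq)
  have hlq0 : 0 < Real.log q := by linarith
  have hqpos : 0 < q := by linarith
  have hlog : Tendsto (fun n : ℕ => Real.log n) atTop atTop :=
    Real.tendsto_log_atTop.comp tendsto_natCast_atTop_atTop
  filter_upwards [hlog.eventually_ge_atTop (4 * Real.log q), hlog.eventually_ge_atTop 1,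
    Filter.eventually_ge_atTop 1] with n hnq hn1 hnpos
  have hnR : (0 : ℝ) < n := by exact_mod_cast (show 0 < n by omega)
  set x := L * Real.log n / Real.log q with hx
  have hx1 : 1 ≤ x := by
    rw [hx, le_div_iff₀ hlq0]
    nlinarith
  have hx0 : 0 ≤ x := by linarith
  have hfloor_le : (⌊x⌋₊ : ℝ) ≤ x := Nat.floor_le hx0
  have hlt : x < (⌊x⌋₊ : ℝ) + 1 := Nat.lt_floor_add_one x
  refine ⟨Nat.le_floor (by exact_mod_cast hx1), by linarith, hfloor_le, ?_, hn1, ?_, ?_⟩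
  · have hx2 : x ≤ 2 * Real.log n := by
      rw [hx, div_le_iff₀ hlq0]
      have h0 : 0 ≤ Real.log n := by linarith
      nlinarith
    linarith
  · rw [Real.rpow_def_of_pos hnR, ← Real.rpow_natCast, Real.rpow_def_of_pos hqpos,
      Real.exp_le_exp]
    push_cast
    have : Real.log n * L = x * Real.log q := by
      rw [hx]; field_simp
    rw [this, mul_comm x]
    exact mul_le_mul_of_nonneg_left hlt.le hlq0.le
  · rw [Real.rpow_def_of_pos hnR, ← Real.rpow_natCast, Real.rpow_def_of_pos hqpos,
      Real.exp_le_exp]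
    have : Real.log n * L = x * Real.log q := by
      rw [hx]; field_simp
    rw [this, mul_comm (Real.log q)]
    exact mul_le_mul_of_nonneg_right hfloor_le hlq0.le

/-- `(log n)² ≤ 16/c² · n^{c/2}... ` in the convenient form: for `c > 0`,
`(log n)^2 · n^{−c} ≤ (4/c²) · n^{−c/2}` (from `log n ≤ n^{c/4}/(c/4)`). [folklore] -/
theorem log_sq_mul_rpow_neg_le {c : ℝ} (hc : 0 < c) {n : ℕ} (hn : 1 ≤ n) :
    (Real.log n) ^ 2 * (n : ℝ) ^ (-c) ≤ (16 / c ^ 2) * (n : ℝ) ^ (-(c / 2)) := by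
  have hnR : (0 : ℝ) < n := by exact_mod_cast (show 0 < n by omega)
  have hn1 : (1 : ℝ) ≤ n := by exact_mod_cast hn
  have hlog0 : 0 ≤ Real.log n := Real.log_nonneg hn1
  have h1 : Real.log n ≤ (n : ℝ) ^ (c / 4) / (c / 4) := Real.log_le_rpow_div hnR.le (by positivity)
  have h2 : (Real.log n) ^ 2 ≤ ((n : ℝ) ^ (c / 4) / (c / 4)) ^ 2 := pow_le_pow_left₀ hlog0 h1 2
  have e : ((n : ℝ) ^ (c / 4) / (c / 4)) ^ 2 * (n : ℝ) ^ (-c) = (16 / c ^ 2) * (n : ℝ) ^ (-(c / 2)) := by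
    rw [div_pow, ← Real.rpow_natCast, ← Real.rpow_mul hnR.le]
    push_cast
    rw [show c / 4 * 2 = c / 2 by ring, div_mul_eq_mul_div, ← Real.rpow_add hnR,
      show c / 2 + -c = -(c / 2) by ring]
    field_simp
    ring
  calc (Real.log n) ^ 2 * (n : ℝ) ^ (-c) ≤ ((n : ℝ) ^ (c / 4) / (c / 4)) ^ 2 * (n : ℝ) ^ (-c) :=
        mul_le_mul_of_nonneg_right h2 (Real.rpow_pos_of_pos hnR _).le
    _ = _ := e

/-- **Accuracy of the floor/ceiling thresholds.** With `η₁ = η + 2r + s₂ + hh/B̄`: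
`⌊(1+η)(1+r)Ā⌋ ≤ (1+η₁)Ā`, `(1−η₁)Ā ≤ ⌈(1−η)(1−s₂)(1−r)Ā⌉`, the same for `B̄` with the shift
`hh`, and `Ā − 1 ≤ ⌊(1+η)(1+r)Ā⌋`, `B̄ − 1 ≤ ⌊(1+η)(1+r)B̄⌋`. [folklore] -/
theorem accuracy_bounds {A B η r s2 s1 hh X2 Y2 X1 Y1 : ℝ} (hA : 0 < A) (hB : 0 < B)
    (hη0 : 0 ≤ η) (hη1 : η ≤ 1) (hr0 : 0 ≤ r) (hs20 : 0 ≤ s2) (hs21 : s2 ≤ 1)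
    (hs10 : 0 ≤ s1) (hs1 : s1 ≤ s2) (hh0 : 0 ≤ hh)
    (hX2 : X2 = (1 + r) * A) (hY2 : Y2 = (1 - s2) * ((1 - r) * A))
    (hX1 : X1 = (1 + r) * B) (hY1 : Y1 = (1 - s1) * ((1 - r) * B)) :
    ((⌊(1 + η) * X2⌋₊ : ℕ) : ℝ) ≤ (1 + (η + 2 * r + s2 + hh / B)) * A ∧
    (1 - (η + 2 * r + s2 + hh / B)) * A ≤ ((⌈(1 - η) * Y2⌉₊ : ℕ) : ℝ) ∧
    ((⌊(1 + η) * X1⌋₊ : ℕ) : ℝ) ≤ (1 + (η + 2 * r + s2 + hh / B)) * B ∧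
    (1 - (η + 2 * r + s2 + hh / B)) * B + hh ≤ ((⌈(1 - η) * Y1⌉₊ : ℕ) : ℝ) ∧
    A - 1 ≤ ((⌊(1 + η) * X2⌋₊ : ℕ) : ℝ) ∧ B - 1 ≤ ((⌊(1 + η) * X1⌋₊ : ℕ) : ℝ) := by
  have hhB : 0 ≤ hh / B := by positivity
  have hX20 : 0 ≤ (1 + η) * X2 := by rw [hX2]; positivity
  have hX10 : 0 ≤ (1 + η) * X1 := by rw [hX1]; positivity
  -- `(1+η)(1+r) ≤ 1 + η + 2r`
  have hup : (1 + η) * (1 + r) ≤ 1 + η + 2 * r := by nlinarith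
  -- `(1-η)(1-s)(1-r) ≥ 1 - η - s - r` for `η, s, r ∈ [0,1]`
  have hlow : ∀ s : ℝ, 0 ≤ s → s ≤ 1 → 1 - η - s - r ≤ (1 - η) * ((1 - s) * (1 - r)) := by
    intro s hs0 hs1
    have h1 : 0 ≤ (1 - η) * (1 - s) := mul_nonneg (by linarith) (by linarith)
    nlinarith [mul_nonneg (mul_nonneg hη0 hs0) hr0, mul_nonneg hη0 hs0, mul_nonneg hη0 hr0,
      mul_nonneg hs0 hr0]
  refine ⟨?_, ?_, ?_, ?_, ?_, ?_⟩
  · calc ((⌊(1 + η) * X2⌋₊ : ℕ) : ℝ) ≤ (1 + η) * X2 := Nat.floor_le hX20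
      _ = ((1 + η) * (1 + r)) * A := by rw [hX2]; ring
      _ ≤ (1 + η + 2 * r) * A := mul_le_mul_of_nonneg_right hup hA.le
      _ ≤ (1 + (η + 2 * r + s2 + hh / B)) * A := by
          apply mul_le_mul_of_nonneg_right _ hA.le; linarith
  · calc (1 - (η + 2 * r + s2 + hh / B)) * A ≤ (1 - η - s2 - r) * A := by
          apply mul_le_mul_of_nonneg_right _ hA.le; linarith
      _ ≤ ((1 - η) * ((1 - s2) * (1 - r))) * A := mul_le_mul_of_nonneg_right (hlow s2 hs20 hs21) hA.le
      _ = (1 - η) * Y2 := by rw [hY2]; ring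
      _ ≤ ((⌈(1 - η) * Y2⌉₊ : ℕ) : ℝ) := Nat.le_ceil _
  · calc ((⌊(1 + η) * X1⌋₊ : ℕ) : ℝ) ≤ (1 + η) * X1 := Nat.floor_le hX10
      _ = ((1 + η) * (1 + r)) * B := by rw [hX1]; ring
      _ ≤ (1 + η + 2 * r) * B := mul_le_mul_of_nonneg_right hup hB.le
      _ ≤ (1 + (η + 2 * r + s2 + hh / B)) * B := by
          apply mul_le_mul_of_nonneg_right _ hB.le; linarith
  · have e : (1 - (η + 2 * r + s2 + hh / B)) * B + hh = (1 - η - 2 * r - s2) * B := by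
      field_simp
      ring
    rw [e]
    calc (1 - η - 2 * r - s2) * B ≤ (1 - η - s1 - r) * B := by
          apply mul_le_mul_of_nonneg_right _ hB.le; linarith
      _ ≤ ((1 - η) * ((1 - s1) * (1 - r))) * B :=
          mul_le_mul_of_nonneg_right (hlow s1 hs10 (hs1.trans hs21)) hB.le
      _ = (1 - η) * Y1 := by rw [hY1]; ring
      _ ≤ ((⌈(1 - η) * Y1⌉₊ : ℕ) : ℝ) := Nat.le_ceil _
  · have h1 : (1 + η) * X2 - 1 < ((⌊(1 + η) * X2⌋₊ : ℕ) : ℝ) := Nat.sub_one_lt_floor _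
    have h2 : A ≤ (1 + η) * X2 := by
      rw [hX2]; nlinarith [mul_nonneg hη0 hr0, mul_nonneg hη0 hA.le, mul_nonneg hr0 hA.le]
    linarith
  · have h1 : (1 + η) * X1 - 1 < ((⌊(1 + η) * X1⌋₊ : ℕ) : ℝ) := Nat.sub_one_lt_floor _
    have h2 : B ≤ (1 + η) * X1 := by
      rw [hX1]; nlinarith [mul_nonneg hη0 hr0, mul_nonneg hη0 hB.le, mul_nonneg hr0 hB.le]
    linarith

/-- **The means.** `n · p₊ = (1 + r) Ā` and `(n − 2S) p₋ = (1 − 2S/n)(1 − r) Ā` with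
`Ā = n / (2k q^{e − (g+2)})`, `r = (2k+1)/q^{g+2}`, where `p± = (q^{g+2} ± (2k+1))/(2k q^{e})`.
[folklore] -/
theorem subword_means {n k q S : ℝ} {g e : ℕ} (hn : 0 < n) (hk : 0 < k) (hq : 0 < q)
    (he : g + 2 ≤ e) :
    n * ((q ^ (g + 2) + 2 * k + 1) / (2 * k * q ^ e)) =
      (1 + (2 * k + 1) / q ^ (g + 2)) * (n / (2 * k * q ^ (e - (g + 2)))) ∧
    (n - 2 * S) * ((q ^ (g + 2) - 2 * k - 1) / (2 * k * q ^ e)) =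
      (1 - 2 * S / n) * ((1 - (2 * k + 1) / q ^ (g + 2)) * (n / (2 * k * q ^ (e - (g + 2))))) := by
  have hqe : q ^ e = q ^ (g + 2) * q ^ (e - (g + 2)) := by
    rw [← pow_add]; congr 1; omega
  have hq2 : 0 < q ^ (g + 2) := pow_pos hq _
  have hq3 : 0 < q ^ (e - (g + 2)) := pow_pos hq _
  constructor
  · rw [hqe]; field_simp; ring
  · rw [hqe]; field_simp; ring

/-- **The Chernoff exponent is large (sharp upper tail).** If `η² = n^{−θ}`, `T₀ ≥ n/(4S)`,
`S ≤ 9 log n`, `p ≥ 1/(4k(2k−1) n^{a})` and `e = 1 − θ − a > 0` with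
`(16/e²) n^{−e/2} ≤ 1/(576 k (2k−1)(C+k+4))`, then `(C + k + 4) log n ≤ η² T₀ p / 4`.
[folklore] -/
theorem sharp_exponent_ge {n : ℕ} {k θ a e C T₀ p S η : ℝ} (hn : 1 ≤ n) (hk : 2 ≤ k)
    (hC : 0 ≤ C) (he0 : 0 < e) (he : e = 1 - θ - a) (hlog : 1 ≤ Real.log n)
    (hη : η ^ 2 = (n : ℝ) ^ (-θ)) (hS0 : 0 < S) (hS : S ≤ 9 * Real.log n)
    (hT₀ : (n : ℝ) / (4 * S) ≤ T₀) (hp : 1 / (4 * k * (2 * k - 1) * (n : ℝ) ^ a) ≤ p)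
    (hsmall : (16 / e ^ 2) * (n : ℝ) ^ (-(e / 2)) ≤ 1 / (576 * k * (2 * k - 1) * (C + k + 4))) :
    (C + k + 4) * Real.log n ≤ η ^ 2 * (T₀ * p) / 4 := by
  have hnR : (0 : ℝ) < n := by exact_mod_cast (show 0 < n by omega)
  have hq : (0 : ℝ) < 2 * k - 1 := by linarith
  have hk0 : (0 : ℝ) < k := by linarith
  have hlogpos : 0 < Real.log n := by linarith
  have hT₀0 : 0 ≤ T₀ := le_trans (by positivity) hT₀
  have hp0 : 0 ≤ p := le_trans (by positivity) hp
  -- `η² T₀ p / 4 ≥ n^e / (64 k q S)`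
  have h1 : (n : ℝ) ^ e / (64 * k * (2 * k - 1) * S) ≤ η ^ 2 * (T₀ * p) / 4 := by
    have h2 : (n : ℝ) ^ (-θ) * ((n : ℝ) / (4 * S) * (1 / (4 * k * (2 * k - 1) * (n : ℝ) ^ a))) ≤
        η ^ 2 * (T₀ * p) := by
      rw [hη]
      apply mul_le_mul_of_nonneg_left _ (Real.rpow_pos_of_pos hnR _).le
      exact mul_le_mul hT₀ hp (by positivity) hT₀0
    have e1 : (n : ℝ) ^ (-θ) * ((n : ℝ) / (4 * S) * (1 / (4 * k * (2 * k - 1) * (n : ℝ) ^ a))) =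
        (n : ℝ) ^ e / (16 * k * (2 * k - 1) * S) := by
      have hna : (0 : ℝ) < (n : ℝ) ^ a := Real.rpow_pos_of_pos hnR _
      rw [he, show (1 : ℝ) - θ - a = -θ + 1 + -a by ring, Real.rpow_add hnR, Real.rpow_add hnR,
        Real.rpow_one, Real.rpow_neg hnR.le a]
      field_simp
      ring
    rw [e1] at h2
    have h3 : (n : ℝ) ^ e / (64 * k * (2 * k - 1) * S) = (n : ℝ) ^ e / (16 * k * (2 * k - 1) * S) / 4 := by
      field_simp; ring
    rw [h3]
    linarith
  refine le_trans ?_ h1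
  -- `(C+k+4) log n ≤ n^e/(64 k q S)` iff `64 k q S (C+k+4) log n ≤ n^e`
  rw [le_div_iff₀ (by positivity)]
  have hlog2 := log_sq_mul_rpow_neg_le he0 hn
  have h4 : (Real.log n) ^ 2 * (n : ℝ) ^ (-e) ≤ 1 / (576 * k * (2 * k - 1) * (C + k + 4)) :=
    hlog2.trans hsmall
  have hne : (n : ℝ) ^ (-e) = ((n : ℝ) ^ e)⁻¹ := Real.rpow_neg hnR.le e
  have hnepos : (0 : ℝ) < (n : ℝ) ^ e := Real.rpow_pos_of_pos hnR _
  rw [hne, ← div_eq_mul_inv, div_le_iff₀ hnepos] at h4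
  -- `576 k q (C+k+4) log² n ≤ n^e`
  have h5 : 576 * k * (2 * k - 1) * (C + k + 4) * (Real.log n) ^ 2 ≤ (n : ℝ) ^ e := by
    have hc0 : (0 : ℝ) < 576 * k * (2 * k - 1) * (C + k + 4) := by positivity
    have := mul_le_mul_of_nonneg_left h4 hc0.le
    have e2 : 576 * k * (2 * k - 1) * (C + k + 4) * (1 / (576 * k * (2 * k - 1) * (C + k + 4)) * (n : ℝ) ^ e) =
        (n : ℝ) ^ e := by
      rw [← mul_assoc, mul_one_div_cancel (ne_of_gt hc0), one_mul]
    linarith [e2.le]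
  calc (C + k + 4) * Real.log n * (64 * k * (2 * k - 1) * S)
      ≤ (C + k + 4) * Real.log n * (64 * k * (2 * k - 1) * (9 * Real.log n)) := by
        apply mul_le_mul_of_nonneg_left _ (by positivity)
        exact mul_le_mul_of_nonneg_left hS (by positivity)
    _ = 576 * k * (2 * k - 1) * (C + k + 4) * (Real.log n) ^ 2 := by ring
    _ ≤ (n : ℝ) ^ e := h5

/-- **The probability factor (sharp upper tail).** [folklore] -/
theorem sharp_prob_factor_le {n k : ℕ} {C T2 T1 S2 S1 X2 X1 : ℝ} (hn : 1 ≤ n) (hk : 1 ≤ k)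
    (hT20 : 0 ≤ T2) (hT2 : T2 ≤ 2 * k * (2 * k - 1) * n) (hT10 : 0 ≤ T1)
    (hT1 : T1 ≤ 2 * k * (2 * k - 1) * n) (hS20 : 0 ≤ S2) (hS2 : S2 ≤ 9 * n) (hS10 : 0 ≤ S1)
    (hS1 : S1 ≤ 9 * n) (hX2 : (C + k + 4) * Real.log n ≤ X2) (hX1 : (C + k + 4) * Real.log n ≤ X1)
    (hs : (n : ℝ) ^ (-(2 : ℝ)) ≤ 1 / (288 * k * (2 * k - 1) * 2 ^ k + 1)) :
    2 * ((n : ℝ) + 1) ^ k * (T2 * (2 * S2 * Real.exp (-X2)) + T1 * (2 * S1 * Real.exp (-X1))) ≤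
      (n : ℝ) ^ (-C) := by
  have hnR : (0 : ℝ) < n := by exact_mod_cast (show 0 < n by omega)
  have hn1 : (1 : ℝ) ≤ n := by exact_mod_cast hn
  have hk1 : (1 : ℝ) ≤ k := by exact_mod_cast hk
  have hq : (1 : ℝ) ≤ 2 * k - 1 := by linarith
  have hexp : ∀ X, (C + k + 4) * Real.log n ≤ X → Real.exp (-X) ≤ (n : ℝ) ^ (-(C + k + 4)) := by
    intro X hX
    calc Real.exp (-X) ≤ Real.exp (-((C + k + 4) * Real.log n)) := Real.exp_le_exp.mpr (by linarith)
      _ = (n : ℝ) ^ (-(C + k + 4)) := by rw [Real.rpow_def_of_pos hnR]; congr 1; ring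
  have hE2 := hexp X2 hX2
  have hE1 := hexp X1 hX1
  have hpos := (Real.rpow_pos_of_pos hnR (-(C + k + 4))).le
  -- each product
  have hprod : ∀ T S E : ℝ, 0 ≤ T → T ≤ 2 * k * (2 * k - 1) * n → 0 ≤ S → S ≤ 9 * n → 0 ≤ E →
      E ≤ (n : ℝ) ^ (-(C + k + 4)) →
      T * (2 * S * E) ≤ 36 * k * (2 * k - 1) * (n : ℝ) ^ 2 * (n : ℝ) ^ (-(C + k + 4)) := by
    intro T S E hT0 hT hS0 hS hE0 hE
    calc T * (2 * S * E) ≤ (2 * k * (2 * k - 1) * n) * (2 * (9 * n) * (n : ℝ) ^ (-(C + k + 4))) := by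
          apply mul_le_mul hT _ (by positivity) (by positivity)
          exact mul_le_mul (by linarith) hE hE0 (by positivity)
      _ = 36 * k * (2 * k - 1) * (n : ℝ) ^ 2 * (n : ℝ) ^ (-(C + k + 4)) := by ring
  have h2 := hprod T2 S2 _ hT20 hT2 hS20 hS2 (Real.exp_pos _).le hE2
  have h1 := hprod T1 S1 _ hT10 hT1 hS10 hS1 (Real.exp_pos _).le hE1
  have hpow : ((n : ℝ) + 1) ^ k ≤ 2 ^ k * (n : ℝ) ^ k := by
    rw [← mul_pow]; exact pow_le_pow_left₀ (by positivity) (by linarith) k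
  have e1 : (n : ℝ) ^ k * (n : ℝ) ^ 2 * (n : ℝ) ^ (-(C + k + 4)) = (n : ℝ) ^ (-(2 : ℝ)) * (n : ℝ) ^ (-C) := by
    rw [← Real.rpow_natCast, ← Real.rpow_natCast _ 2, ← Real.rpow_add hnR, ← Real.rpow_add hnR,
      ← Real.rpow_add hnR]
    congr 1; push_cast; ring
  have hposC : (0 : ℝ) ≤ (n : ℝ) ^ (-C) := (Real.rpow_pos_of_pos hnR _).le
  calc 2 * ((n : ℝ) + 1) ^ k * (T2 * (2 * S2 * Real.exp (-X2)) + T1 * (2 * S1 * Real.exp (-X1)))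
      ≤ 2 * (2 ^ k * (n : ℝ) ^ k) * (2 * (36 * k * (2 * k - 1) * (n : ℝ) ^ 2 * (n : ℝ) ^ (-(C + k + 4)))) := by
        apply mul_le_mul (mul_le_mul_of_nonneg_left hpow (by norm_num)) (by linarith) (by positivity)
          (by positivity)
    _ = 144 * k * (2 * k - 1) * 2 ^ k * ((n : ℝ) ^ k * (n : ℝ) ^ 2 * (n : ℝ) ^ (-(C + k + 4))) := by ring
    _ = 144 * k * (2 * k - 1) * 2 ^ k * ((n : ℝ) ^ (-(2 : ℝ)) * (n : ℝ) ^ (-C)) := by rw [e1]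
    _ ≤ 144 * k * (2 * k - 1) * 2 ^ k * ((1 / (288 * k * (2 * k - 1) * 2 ^ k + 1)) * (n : ℝ) ^ (-C)) := by
        apply mul_le_mul_of_nonneg_left _ (by positivity)
        exact mul_le_mul_of_nonneg_right hs hposC
    _ ≤ (n : ℝ) ^ (-C) := by
        rw [← mul_assoc]
        apply mul_le_of_le_one_left hposC
        rw [mul_one_div, div_le_one (by positivity)]
        have : (0 : ℝ) ≤ 144 * k * (2 * k - 1) * 2 ^ k := by positivity
        linarith

/-- `(2k − 1)³ ≥ 4k + 2` for `k ≥ 2`. [folklore] -/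
theorem cube_ge_of_two_le {k : ℝ} (hk : 2 ≤ k) : 4 * k + 2 ≤ (2 * k - 1) ^ 3 := by
  nlinarith [sq_nonneg (2 * k - 1), mul_nonneg (by linarith : (0 : ℝ) ≤ 2 * k - 3) (sq_nonneg (2 * k - 1))]

/-- Lower bound for the subword probability `p₋ = (P − 2k − 1)/(2k P Q)`, `P = q^{g+2} ≥ 4k+2`,
`Q ≤ q N`. [folklore] -/
theorem pm_lower_bound {k q P Q N : ℝ} (hk : 0 < k) (hq : 0 < q) (hP : 4 * k + 2 ≤ P)
    (hQ0 : 0 < Q) (hQ : Q ≤ q * N) (hN : 0 < N) :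
    1 / (4 * k * q * N) ≤ (P - 2 * k - 1) / (2 * k * (P * Q)) := by
  have hP0 : 0 < P := by linarith
  rw [div_le_div_iff₀ (by positivity) (by positivity)]
  have h2 : P ≤ 2 * (P - 2 * k - 1) := by linarith
  have h3 : (0 : ℝ) ≤ q * N := by positivity
  calc 1 * (2 * k * (P * Q)) ≤ 2 * k * (P * (q * N)) := by nlinarith [mul_le_mul_of_nonneg_left hQ hP0.le]
    _ ≤ 2 * k * (2 * (P - 2 * k - 1) * (q * N)) := by
        apply mul_le_mul_of_nonneg_left _ (by positivity)
        exact mul_le_mul_of_nonneg_right h2 h3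
    _ = (P - 2 * k - 1) * (4 * k * q * N) := by ring

/-- Lower bound for the number of windows per residue class: `n/(4S) ≤ ⌊(n − S)/S⌋` when
`4S ≤ n`. [folklore] -/
theorem T0_lower_bound (n S : ℕ) (hS : 0 < S) (hSn : 4 * S ≤ n) :
    (n : ℝ) / (4 * (S : ℝ)) ≤ (((n - S) / S : ℕ) : ℝ) := by
  have h1 := natDiv_ge (n - S) S hS
  have hSR : (0 : ℝ) < S := by exact_mod_cast hS
  rw [Nat.cast_sub (by omega)] at h1
  have h2 : (n : ℝ) / (4 * S) ≤ ((n : ℝ) - S) / S - 1 := by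
    rw [div_le_iff₀ (by positivity)]
    have e : (((n : ℝ) - S) / S - 1) * (4 * S) = 4 * n - 8 * S := by field_simp; ring
    rw [e]
    have : ((4 * S : ℕ) : ℝ) ≤ n := by exact_mod_cast hSn
    push_cast at this
    linarith
  linarith

/-- **The accuracy `η₁` is small.** [folklore] -/
theorem eta1_small {n : ℕ} {k θ ε₀ η r s2 hB : ℝ} (hn : 1 ≤ n) (hk : 2 ≤ k) (hθ : 0 < θ)
    (hθ8 : θ ≤ 1 / 8) (hε₀ : 0 < ε₀) (hlog : 1 ≤ Real.log n)
    (hη : η = (n : ℝ) ^ (-(θ / 2))) (hr : r ≤ 3 * (n : ℝ) ^ (-(1 / 2 - θ)))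
    (hs2 : s2 ≤ 18 * Real.log n / n)
    (hhB : hB ≤ 6 * k * (2 * k - 1) * Real.log n * (n : ℝ) ^ (1 / 2 - θ) / n)
    (hsm1 : (n : ℝ) ^ (-(θ / 4)) ≤ ε₀ * θ / 144)
    (hsm2 : (n : ℝ) ^ (-(1 / 4 : ℝ)) ≤ ε₀ / (13824 * k * (2 * k - 1)))
    (hsm3 : (n : ℝ) ^ (-(1 / 2 : ℝ)) ≤ ε₀ / 10368) :
    (η + 2 * r + s2 + hB) * Real.log n ≤ ε₀ / 9 := by
  have hnR : (0 : ℝ) < n := by exact_mod_cast (show 0 < n by omega)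
  have hlog0 : 0 ≤ Real.log n := by linarith
  have hkq : (6 : ℝ) ≤ k * (2 * k - 1) := by nlinarith
  have hkq0 : (0 : ℝ) < k * (2 * k - 1) := by linarith
  have hkne : (k : ℝ) ≠ 0 := by positivity
  have hqne : (2 * k - 1 : ℝ) ≠ 0 := by
    have : (0 : ℝ) < 2 * k - 1 := by linarith
    exact this.ne'
  have hθne : θ ≠ 0 := hθ.ne'
  -- (i) `η log n ≤ ε₀/36`
  have h1 : η * Real.log n ≤ ε₀ / 36 := by
    have hl : Real.log n ≤ (n : ℝ) ^ (θ / 4) / (θ / 4) := Real.log_le_rpow_div hnR.le (by positivity)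
    rw [hη]
    calc (n : ℝ) ^ (-(θ / 2)) * Real.log n ≤ (n : ℝ) ^ (-(θ / 2)) * ((n : ℝ) ^ (θ / 4) / (θ / 4)) :=
          mul_le_mul_of_nonneg_left hl (Real.rpow_pos_of_pos hnR _).le
      _ = (4 / θ) * (n : ℝ) ^ (-(θ / 4)) := by
          rw [show (n : ℝ) ^ (-(θ / 2)) * ((n : ℝ) ^ (θ / 4) / (θ / 4)) =
              ((n : ℝ) ^ (-(θ / 2)) * (n : ℝ) ^ (θ / 4)) * (4 / θ) by field_simp,
            ← Real.rpow_add hnR, show -(θ / 2) + θ / 4 = -(θ / 4) by ring, mul_comm]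
      _ ≤ (4 / θ) * (ε₀ * θ / 144) := mul_le_mul_of_nonneg_left hsm1 (by positivity)
      _ = ε₀ / 36 := by field_simp; ring
  -- (ii) `r log n ≤ ε₀/72`
  have h2 : r * Real.log n ≤ ε₀ / 72 := by
    have hl : Real.log n ≤ (n : ℝ) ^ (1 / 8 : ℝ) / (1 / 8) := Real.log_le_rpow_div hnR.le (by norm_num)
    have hexp : (n : ℝ) ^ (-(1 / 2 - θ)) * (n : ℝ) ^ (1 / 8 : ℝ) ≤ (n : ℝ) ^ (-(1 / 4 : ℝ)) := by
      rw [← Real.rpow_add hnR]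
      apply Real.rpow_le_rpow_of_exponent_le (by exact_mod_cast hn)
      linarith
    calc r * Real.log n ≤ (3 * (n : ℝ) ^ (-(1 / 2 - θ))) * ((n : ℝ) ^ (1 / 8 : ℝ) / (1 / 8)) :=
          mul_le_mul hr hl hlog0 (by positivity)
      _ = 24 * ((n : ℝ) ^ (-(1 / 2 - θ)) * (n : ℝ) ^ (1 / 8 : ℝ)) := by ring
      _ ≤ 24 * (n : ℝ) ^ (-(1 / 4 : ℝ)) := mul_le_mul_of_nonneg_left hexp (by norm_num)
      _ ≤ 24 * (ε₀ / (13824 * k * (2 * k - 1))) := mul_le_mul_of_nonneg_left hsm2 (by norm_num)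
      _ = ε₀ / (576 * (k * (2 * k - 1))) := by
          rw [mul_div_assoc', div_eq_div_iff (mul_ne_zero (mul_ne_zero (by norm_num) hkne) hqne)
            (mul_ne_zero (by norm_num) (mul_ne_zero hkne hqne))]
          ring
      _ ≤ ε₀ / 72 := by
          apply div_le_div_of_nonneg_left hε₀.le (by norm_num)
          linarith
  -- (iii) `s2 log n ≤ ε₀/36`
  have hlog2 := log_sq_mul_rpow_neg_le (c := 1) one_pos hn
  have hn1 : (n : ℝ) ^ (-(1 : ℝ)) = 1 / n := by
    rw [Real.rpow_neg hnR.le, Real.rpow_one, one_div]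
  have h3 : s2 * Real.log n ≤ ε₀ / 36 := by
    calc s2 * Real.log n ≤ (18 * Real.log n / n) * Real.log n := mul_le_mul_of_nonneg_right hs2 hlog0
      _ = 18 * ((Real.log n) ^ 2 * (n : ℝ) ^ (-(1 : ℝ))) := by rw [hn1]; ring
      _ ≤ 18 * ((16 / 1 ^ 2) * (n : ℝ) ^ (-(1 / 2 : ℝ))) := by
          apply mul_le_mul_of_nonneg_left _ (by norm_num)
          simpa using hlog2
      _ ≤ 18 * ((16 / 1 ^ 2) * (ε₀ / 10368)) := by
          apply mul_le_mul_of_nonneg_left _ (by norm_num)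
          exact mul_le_mul_of_nonneg_left hsm3 (by norm_num)
      _ = ε₀ / 36 := by ring
  -- (iv) `hB log n ≤ ε₀/36`
  have hlog3 := log_sq_mul_rpow_neg_le (c := 1 / 2) (by norm_num) hn
  have h4 : hB * Real.log n ≤ ε₀ / 36 := by
    have e1 : (n : ℝ) ^ (1 / 2 - θ) / n = (n : ℝ) ^ (-(1 / 2 : ℝ)) * (n : ℝ) ^ (-θ) := by
      rw [← Real.rpow_add hnR, div_eq_mul_inv, ← Real.rpow_neg_one, ← Real.rpow_add hnR]
      congr 1; ring
    have hθ1 : (n : ℝ) ^ (-θ) ≤ 1 :=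
      Real.rpow_le_one_of_one_le_of_nonpos (by exact_mod_cast hn) (by linarith)
    calc hB * Real.log n ≤ (6 * k * (2 * k - 1) * Real.log n * (n : ℝ) ^ (1 / 2 - θ) / n) * Real.log n :=
          mul_le_mul_of_nonneg_right hhB hlog0
      _ = 6 * (k * (2 * k - 1)) * (((Real.log n) ^ 2 * (n : ℝ) ^ (-(1 / 2 : ℝ))) * (n : ℝ) ^ (-θ)) := by
          rw [mul_div_assoc, e1]; ring
      _ ≤ 6 * (k * (2 * k - 1)) * (((16 / (1 / 2) ^ 2) * (n : ℝ) ^ (-(1 / 2 / 2 : ℝ))) * 1) := by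
          apply mul_le_mul_of_nonneg_left _ (by positivity)
          exact mul_le_mul hlog3 hθ1 (Real.rpow_pos_of_pos hnR _).le (by positivity)
      _ = 384 * (k * (2 * k - 1)) * (n : ℝ) ^ (-(1 / 4 : ℝ)) := by norm_num; ring
      _ ≤ 384 * (k * (2 * k - 1)) * (ε₀ / (13824 * k * (2 * k - 1))) :=
          mul_le_mul_of_nonneg_left hsm2 (by positivity)
      _ = ε₀ / 36 := by
          rw [mul_div_assoc', div_eq_div_iff (mul_ne_zero (mul_ne_zero (by norm_num) hkne) hqne)
            (by norm_num)]
          ring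
  have : (η + 2 * r + s2 + hB) * Real.log n =
      η * Real.log n + 2 * (r * Real.log n) + s2 * Real.log n + hB * Real.log n := by ring
  rw [this]
  linarith

end SharpUpperLemmas

section Final

open scoped Classical

set_option maxHeartbeats 1600000 in
/-- **Calegari–Walker Prop. 4.2: the upper tail of scl of a random word, sharp constant `1/6`.**
For `k ≥ 2`, `ε > 0`, `C > 1` there is `K` with, for all large `n`,
`#{v ∈ F_n' : scl(v) log n / n > log(2k−1)/6 + ε} ≤ K n^{−C} |F_n'|`.
(Rigid tripod copies of prong length `h = ⌊(1/2 − θ) log n / log(2k−1)⌋` glued by rank along the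
joint involution, `scl_le_of_subwordCounts`; the subword counts of lengths `2h+2`, `h+2` are
concentrated by Prop. 2.3, `card_filter_badCounts_le`; transfer to `[F,F]` by Sharp's theorem.)
[cite: CalegariWalker2013, Prop. 4.2] -/
theorem CalegariWalker2013_sclUpperTail (k : ℕ) (hk : 2 ≤ k) (ε : ℝ) (hε : 0 < ε)
    (C : ℝ) (hC : 1 < C) :
    ∃ K : ℝ, ∀ᶠ n : ℕ in atTop,
      ((((commutatorWords k n).filter fun w =>
          Real.log (2 * k - 1) / 6 + ε <
            stableCommutatorLength (FreeGroup.mk (List.ofFn w)) * Real.log n / n).card : ℕ) : ℝ) ≤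
        K * (n : ℝ) ^ (-C) * ((commutatorWords k n).card : ℝ) := by
  -- constants
  have hk2 : (2 : ℝ) ≤ k := by exact_mod_cast hk
  have hk1 : (1 : ℝ) ≤ k := by linarith
  have hq3 : (3 : ℝ) ≤ 2 * k - 1 := by linarith
  have hqpos : (0 : ℝ) < 2 * k - 1 := by linarith
  have hq1 : (1 : ℝ) ≤ 2 * k - 1 := by linarith
  have hlq : 1 < Real.log (2 * k - 1) :=
    one_lt_log_three.trans_le (Real.log_le_log (by norm_num) hq3)
  have hlq0 : 0 < Real.log (2 * k - 1) := by linarith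
  set ε₀ : ℝ := min ε 1 with hε₀
  have hε₀pos : 0 < ε₀ := lt_min hε one_pos
  have hε₀1 : ε₀ ≤ 1 := min_le_right _ _
  have hε₀ε : ε₀ ≤ ε := min_le_left _ _
  set θ : ℝ := min (1 / 8) (ε₀ / (4 * Real.log (2 * k - 1))) with hθdef
  have hθpos : 0 < θ := lt_min (by norm_num) (by positivity)
  have hθ8 : θ ≤ 1 / 8 := min_le_left _ _
  have hθε : θ ≤ ε₀ / (4 * Real.log (2 * k - 1)) := min_le_right _ _
  have hCk : (0 : ℝ) < C + k + 4 := by linarith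
  have hlogt : Tendsto (fun n : ℕ => Real.log n) atTop atTop :=
    Real.tendsto_log_atTop.comp tendsto_natCast_atTop_atTop
  refine ⟨1, ?_⟩
  filter_upwards [transfer_to_commutatorWords k hk,
    eventually_windowLength_half (q := 2 * k - 1) (L := 1 / 2 - θ) hq3 (by linarith) (by linarith),
    hlogt.eventually_ge_atTop (Real.log (2 * k - 1) / θ),
    eventually_rpow_neg_le (c := θ / 4) (B := ε₀ * θ / 144) (by positivity) (by positivity),
    eventually_rpow_neg_le (c := 1 / 4) (B := ε₀ / (13824 * k * (2 * k - 1)))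
      (by norm_num) (by positivity),
    eventually_rpow_neg_le (c := 1 / 2) (B := ε₀ / 10368) (by norm_num) (by positivity),
    eventually_rpow_neg_le (c := 2 * θ) (B := 1 / (4 * k * (2 * k - 1))) (by positivity) (by positivity),
    eventually_rpow_neg_le (c := 1 / 2) (B := 1 / 120) (by norm_num) (by norm_num),
    eventually_rpow_neg_le (c := θ / 2) (B := θ ^ 2 / (9216 * k * (2 * k - 1) * (C + k + 4)))
      (by positivity) (by positivity),
    eventually_rpow_neg_le (c := 1 / 4) (B := 1 / (36864 * k * (2 * k - 1) * (C + k + 4)))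
      (by norm_num) (by positivity),
    eventually_rpow_neg_le (c := 2) (B := 1 / (288 * k * (2 * k - 1) * 2 ^ k + 1))
      (by norm_num) (by positivity),
    Filter.eventually_ge_atTop 2] with n htr hwin hlogq hs1 hs2 hs3 hs6 hs7 hs8 hs9 hs10 hn2
  obtain ⟨hh1, hhge, hhle, hh3, hlog1, hnL, hqh⟩ := hwin
  rcases Nat.even_or_odd n with heven | hodd
  swap
  · rw [commutatorWords_eq_empty_of_odd k hodd]
    simp
  have hn1 : 1 ≤ n := by omega
  have hnR : (0 : ℝ) < n := by exact_mod_cast (show 0 < n by omega)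
  have hn1R : (1 : ℝ) ≤ n := by exact_mod_cast hn1
  have hlogpos : 0 < Real.log n := by linarith
  -- ### the parameters for this `n`
  set h : ℕ := ⌊(1 / 2 - θ) * Real.log n / Real.log (2 * k - 1)⌋₊ with hhdef
  obtain ⟨ℓ, hℓ⟩ : ∃ ℓ, h = ℓ + 1 := ⟨h - 1, by omega⟩
  have hhR : ((ℓ : ℝ) + 1) = (h : ℝ) := by rw [hℓ]; push_cast; ring
  set q : ℝ := 2 * k - 1 with hqdef
  set η : ℝ := (n : ℝ) ^ (-(θ / 2)) with hηdef
  have hη0 : 0 ≤ η := (Real.rpow_pos_of_pos hnR _).le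
  have hη1 : η ≤ 1 := Real.rpow_le_one_of_one_le_of_nonpos hn1R (by linarith)
  have hη2 : η ^ 2 = (n : ℝ) ^ (-θ) := by
    rw [hηdef, ← Real.rpow_natCast, ← Real.rpow_mul hnR.le]; congr 1; push_cast; ring
  -- `h + 1 ≤ 3 log n`, `log n ≤ 2 √n`, `n ≥ 20 (h + 1)`
  have hh3' : (h : ℝ) + 1 ≤ 3 * Real.log n := hh3
  have hlogsqrt : Real.log n ≤ 2 * (n : ℝ) ^ (1 / 2 : ℝ) := by
    have := Real.log_le_rpow_div hnR.le (by norm_num : (0 : ℝ) < 1 / 2)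
    linarith [this]
  have hsqrt : (120 : ℝ) ≤ (n : ℝ) ^ (1 / 2 : ℝ) := by
    have hpos : (0 : ℝ) < (n : ℝ) ^ (1 / 2 : ℝ) := Real.rpow_pos_of_pos hnR _
    have e : (n : ℝ) ^ (-(1 / 2 : ℝ)) = ((n : ℝ) ^ (1 / 2 : ℝ))⁻¹ := Real.rpow_neg hnR.le _
    rw [e, inv_le_comm₀ hpos (by norm_num)] at hs7
    simpa using hs7
  have hnsq : (n : ℝ) = (n : ℝ) ^ (1 / 2 : ℝ) * (n : ℝ) ^ (1 / 2 : ℝ) := by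
    rw [← Real.rpow_add hnR]; norm_num
  have hn20 : 20 * ((h : ℝ) + 1) ≤ n := by
    have h1 : 20 * ((h : ℝ) + 1) ≤ 120 * (n : ℝ) ^ (1 / 2 : ℝ) := by linarith
    have h2 : 120 * (n : ℝ) ^ (1 / 2 : ℝ) ≤ n := by
      calc 120 * (n : ℝ) ^ (1 / 2 : ℝ) ≤ (n : ℝ) ^ (1 / 2 : ℝ) * (n : ℝ) ^ (1 / 2 : ℝ) :=
            mul_le_mul_of_nonneg_right hsqrt (Real.rpow_pos_of_pos hnR _).le
        _ = n := hnsq.symm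
    linarith
  have hn20N : 20 * (h + 1) ≤ n := by exact_mod_cast hn20
  -- powers of `q`
  have hqh' : q ^ h ≤ (n : ℝ) ^ (1 / 2 - θ) := hqh
  have hnL' : (n : ℝ) ^ (1 / 2 - θ) ≤ q ^ (h + 1) := hnL
  have hq2h1 : q ^ (2 * h + 1) ≤ q * (n : ℝ) ^ (1 - 2 * θ) := by
    have e : q ^ (2 * h + 1) = q * (q ^ h * q ^ h) := by ring
    rw [e]
    apply mul_le_mul_of_nonneg_left _ hqpos.le
    have e2 : (n : ℝ) ^ (1 - 2 * θ) = (n : ℝ) ^ (1 / 2 - θ) * (n : ℝ) ^ (1 / 2 - θ) := by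
      rw [← Real.rpow_add hnR]; congr 1; ring
    rw [e2]
    exact mul_le_mul hqh' hqh' (pow_nonneg hqpos.le _) (Real.rpow_pos_of_pos hnR _).le
  have hqh1 : q ^ (h + 1) ≤ q * (n : ℝ) ^ (1 / 2 - θ) := by
    rw [pow_succ, mul_comm]; exact mul_le_mul_of_nonneg_left hqh' hqpos.le
  have hn12 : (n : ℝ) ^ (1 - 2 * θ) ≤ n := by
    calc (n : ℝ) ^ (1 - 2 * θ) ≤ (n : ℝ) ^ (1 : ℝ) := Real.rpow_le_rpow_of_exponent_le hn1R (by linarith)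
      _ = n := Real.rpow_one _
  have hn12' : (n : ℝ) ^ (1 / 2 - θ) ≤ n := by
    calc (n : ℝ) ^ (1 / 2 - θ) ≤ (n : ℝ) ^ (1 : ℝ) := Real.rpow_le_rpow_of_exponent_le hn1R (by linarith)
      _ = n := Real.rpow_one _
  -- ### the good event
  set GOOD : (Fin n → Fin k × Bool) → Prop := fun w => (∀ σ ∈ reducedWords k (2 * (ℓ + 1) + 1 + 1),
        ⌈(1 - η) * (((n : ℝ) - 2 * ((ℓ + 1) + 1 + (2 * (ℓ + 1) + 1 + 1) : ℕ)) *
          (((2 * k - 1 : ℝ) ^ ((ℓ + 1) + 2) - 2 * k - 1) /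
            (2 * k * (2 * k - 1 : ℝ) ^ ((ℓ + 1) + 1 + (2 * (ℓ + 1) + 1 + 1)))))⌉₊ ≤
        ((Finset.range (n - ((ℓ + 1) + 1 + (2 * (ℓ + 1) + 1)))).filter fun J => 1 ≤ J ∧
          ∃ hJ : J + ((ℓ + 1) + 1) + (2 * (ℓ + 1) + 1) < n, ∀ q : Fin (2 * (ℓ + 1) + 1 + 1),
            w ⟨J + ((ℓ + 1) + 1) + q, by omega⟩ = σ q).card ∧
        ((Finset.range (n - ((ℓ + 1) + 1 + (2 * (ℓ + 1) + 1)))).filter fun J => 1 ≤ J ∧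
          ∃ hJ : J + ((ℓ + 1) + 1) + (2 * (ℓ + 1) + 1) < n, ∀ q : Fin (2 * (ℓ + 1) + 1 + 1),
            w ⟨J + ((ℓ + 1) + 1) + q, by omega⟩ = σ q).card ≤
        ⌊(1 + η) * (n * (((2 * k - 1 : ℝ) ^ ((ℓ + 1) + 2) + 2 * k + 1) /
          (2 * k * (2 * k - 1 : ℝ) ^ ((ℓ + 1) + 1 + (2 * (ℓ + 1) + 1 + 1)))))⌋₊) ∧
      (∀ ρ ∈ reducedWords k ((ℓ + 1) + 1 + 1),
        ⌈(1 - η) * (((n : ℝ) - 2 * ((ℓ + 1) + 1 + ((ℓ + 1) + 1 + 1) : ℕ)) *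
          (((2 * k - 1 : ℝ) ^ ((ℓ + 1) + 2) - 2 * k - 1) /
            (2 * k * (2 * k - 1 : ℝ) ^ ((ℓ + 1) + 1 + ((ℓ + 1) + 1 + 1)))))⌉₊ ≤
        ((Finset.range (n - ((ℓ + 1) + 1 + ((ℓ + 1) + 1)))).filter fun J => 1 ≤ J ∧
          ∃ hJ : J + ((ℓ + 1) + 1) + ((ℓ + 1) + 1) < n, ∀ q : Fin ((ℓ + 1) + 1 + 1),
            w ⟨J + ((ℓ + 1) + 1) + q, by omega⟩ = ρ q).card ∧
        ((Finset.range (n - ((ℓ + 1) + 1 + ((ℓ + 1) + 1)))).filter fun J => 1 ≤ J ∧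
          ∃ hJ : J + ((ℓ + 1) + 1) + ((ℓ + 1) + 1) < n, ∀ q : Fin ((ℓ + 1) + 1 + 1),
            w ⟨J + ((ℓ + 1) + 1) + q, by omega⟩ = ρ q).card ≤
        ⌊(1 + η) * (n * (((2 * k - 1 : ℝ) ^ ((ℓ + 1) + 2) + 2 * k + 1) /
          (2 * k * (2 * k - 1 : ℝ) ^ ((ℓ + 1) + 1 + ((ℓ + 1) + 1 + 1)))))⌋₊) with hGOOD
  -- a cheap decidability instance for `¬ GOOD` (all filters below use it)
  letI instG : DecidablePred fun w : Fin n → Fin k × Bool => ¬ GOOD w := Classical.decPred _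
  -- ### the measure of the bad set
  have hbad := card_filter_badCounts_le k n ℓ hk hη0 hη1
  -- ### abbreviations
  set S2 : ℕ := (ℓ + 1) + 1 + (2 * (ℓ + 1) + 1 + 1) with hS2
  set S1 : ℕ := (ℓ + 1) + 1 + ((ℓ + 1) + 1 + 1) with hS1
  set pm2 : ℝ := ((2 * k - 1 : ℝ) ^ ((ℓ + 1) + 2) - 2 * k - 1) /
    (2 * k * (2 * k - 1 : ℝ) ^ ((ℓ + 1) + 1 + (2 * (ℓ + 1) + 1 + 1))) with hpm2
  set pp2 : ℝ := ((2 * k - 1 : ℝ) ^ ((ℓ + 1) + 2) + 2 * k + 1) /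
    (2 * k * (2 * k - 1 : ℝ) ^ ((ℓ + 1) + 1 + (2 * (ℓ + 1) + 1 + 1))) with hpp2
  set pm1 : ℝ := ((2 * k - 1 : ℝ) ^ ((ℓ + 1) + 2) - 2 * k - 1) /
    (2 * k * (2 * k - 1 : ℝ) ^ ((ℓ + 1) + 1 + ((ℓ + 1) + 1 + 1))) with hpm1
  set pp1 : ℝ := ((2 * k - 1 : ℝ) ^ ((ℓ + 1) + 2) + 2 * k + 1) /
    (2 * k * (2 * k - 1 : ℝ) ^ ((ℓ + 1) + 1 + ((ℓ + 1) + 1 + 1))) with hpp1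
  set T02 : ℕ := (n - S2) / S2 with hT02
  set T01 : ℕ := (n - S1) / S1 with hT01
  set F2 : ℝ := ((reducedWords k (2 * (ℓ + 1) + 1 + 1)).card : ℝ) with hF2
  set F1 : ℝ := ((reducedWords k ((ℓ + 1) + 1 + 1)).card : ℝ) with hF1
  have hS2R : ((S2 : ℕ) : ℝ) = 3 * (h : ℝ) + 3 := by rw [hS2, ← hhR]; push_cast; ring
  have hS1R : ((S1 : ℕ) : ℝ) = 2 * (h : ℝ) + 3 := by rw [hS1, ← hhR]; push_cast; ring
  have hS2le : ((S2 : ℕ) : ℝ) ≤ 9 * Real.log n := by rw [hS2R]; linarith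
  have hS1le : ((S1 : ℕ) : ℝ) ≤ 9 * Real.log n := by rw [hS1R]; linarith
  have hS2pos : (0 : ℝ) < (S2 : ℕ) := by rw [hS2R]; positivity
  have hS1pos : (0 : ℝ) < (S1 : ℕ) := by rw [hS1R]; positivity
  have hnS2 : 4 * S2 ≤ n := by
    have : ((4 * S2 : ℕ) : ℝ) ≤ n := by push_cast; rw [hS2R]; linarith
    exact_mod_cast this
  have hnS1 : 4 * S1 ≤ n := by
    have : ((4 * S1 : ℕ) : ℝ) ≤ n := by push_cast; rw [hS1R]; linarith
    exact_mod_cast this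
  have hlogn9 : 9 * Real.log n ≤ 9 * n := by
    have : Real.log n ≤ n := by
      have h1 : Real.log n ≤ (n : ℝ) - 1 := Real.log_le_sub_one_of_pos hnR
      linarith
    linarith
  -- `q^{h+2} ≥ 4k + 2`
  have hq42 : 4 * (k : ℝ) + 2 ≤ q ^ ((ℓ + 1) + 2) := by
    have h3 : q ^ 3 ≤ q ^ ((ℓ + 1) + 2) := pow_le_pow_right₀ hq1 (by omega)
    have h4 : 4 * (k : ℝ) + 2 ≤ q ^ 3 := cube_ge_of_two_le hk2
    linarith
  -- the probabilities from below
  have hk0 : (0 : ℝ) < k := by linarith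
  have hpm2ge : 1 / (4 * k * (2 * k - 1) * (n : ℝ) ^ (1 - 2 * θ)) ≤ pm2 := by
    have e : (2 * k - 1 : ℝ) ^ ((ℓ + 1) + 1 + (2 * (ℓ + 1) + 1 + 1)) =
        q ^ ((ℓ + 1) + 2) * q ^ (2 * h + 1) := by
      rw [hqdef, ← pow_add]; congr 1; omega
    rw [hpm2, e]
    exact pm_lower_bound hk0 hqpos hq42 (pow_pos hqpos _) hq2h1 (Real.rpow_pos_of_pos hnR _)
  have hpm1ge : 1 / (4 * k * (2 * k - 1) * (n : ℝ) ^ (1 / 2 - θ)) ≤ pm1 := by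
    have e : (2 * k - 1 : ℝ) ^ ((ℓ + 1) + 1 + ((ℓ + 1) + 1 + 1)) =
        q ^ ((ℓ + 1) + 2) * q ^ (h + 1) := by
      rw [hqdef, ← pow_add]; congr 1; omega
    rw [hpm1, e]
    exact pm_lower_bound hk0 hqpos hq42 (pow_pos hqpos _) hqh1 (Real.rpow_pos_of_pos hnR _)
  -- the `T₀`'s from below
  have hT02ge := T0_lower_bound n S2 (by omega) hnS2
  have hT01ge := T0_lower_bound n S1 (by omega) hnS1
  -- the Chernoff exponents
  have hX2 : (C + k + 4) * Real.log n ≤ η ^ 2 * ((T02 : ℝ) * pm2) / 4 :=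
    sharp_exponent_ge (a := 1 - 2 * θ) (e := θ) hn1 hk2 (by linarith) hθpos (by ring) hlog1 hη2
      hS2pos hS2le hT02ge hpm2ge (by
        calc 16 / θ ^ 2 * (n : ℝ) ^ (-(θ / 2)) ≤ 16 / θ ^ 2 * (θ ^ 2 / (9216 * k * (2 * k - 1) * (C + k + 4))) :=
              mul_le_mul_of_nonneg_left hs8 (by positivity)
          _ = 1 / (576 * k * (2 * k - 1) * (C + k + 4)) := by field_simp; ring)
  have hX1 : (C + k + 4) * Real.log n ≤ η ^ 2 * ((T01 : ℝ) * pm1) / 4 :=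
    sharp_exponent_ge (a := 1 / 2 - θ) (e := 1 / 2) hn1 hk2 (by linarith) (by norm_num) (by ring) hlog1
      hη2 hS1pos hS1le hT01ge hpm1ge (by
        have e : (16 : ℝ) / (1 / 2) ^ 2 * (n : ℝ) ^ (-(1 / 2 / 2 : ℝ)) = 64 * (n : ℝ) ^ (-(1 / 4 : ℝ)) := by
          norm_num
        rw [e]
        calc 64 * (n : ℝ) ^ (-(1 / 4 : ℝ)) ≤ 64 * (1 / (36864 * k * (2 * k - 1) * (C + k + 4))) :=
              mul_le_mul_of_nonneg_left hs9 (by norm_num)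
          _ = 1 / (576 * k * (2 * k - 1) * (C + k + 4)) := by field_simp; ring)
  -- sizes of the type sets
  have hF2le : F2 ≤ 2 * k * (2 * k - 1) * n := by
    rw [hF2, card_reducedWords k (by omega : 1 ≤ 2 * (ℓ + 1) + 1 + 1)]
    have e1 : 2 * (ℓ + 1) + 1 + 1 - 1 = 2 * h + 1 := by omega
    rw [e1]
    push_cast [Nat.cast_sub (show 1 ≤ 2 * k by omega)]
    have h1 := hq2h1.trans (mul_le_mul_of_nonneg_left hn12 hqpos.le)
    rw [hqdef] at h1
    calc 2 * (k : ℝ) * (2 * k - 1) ^ (2 * h + 1) ≤ 2 * k * ((2 * k - 1) * n) :=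
          mul_le_mul_of_nonneg_left h1 (by positivity)
      _ = 2 * k * (2 * k - 1) * n := by ring
  have hF1le : F1 ≤ 2 * k * (2 * k - 1) * n := by
    rw [hF1, card_reducedWords k (by omega : 1 ≤ (ℓ + 1) + 1 + 1)]
    have e1 : (ℓ + 1) + 1 + 1 - 1 = h + 1 := by omega
    rw [e1]
    push_cast [Nat.cast_sub (show 1 ≤ 2 * k by omega)]
    have h1 := hqh1.trans (mul_le_mul_of_nonneg_left hn12' hqpos.le)
    rw [hqdef] at h1
    calc 2 * (k : ℝ) * (2 * k - 1) ^ (h + 1) ≤ 2 * k * ((2 * k - 1) * n) :=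
          mul_le_mul_of_nonneg_left h1 (by positivity)
      _ = 2 * k * (2 * k - 1) * n := by ring
  have hprob := sharp_prob_factor_le (k := k) (C := C) (T2 := F2) (T1 := F1) (S2 := (S2 : ℝ))
    (S1 := (S1 : ℝ)) hn1 (by omega) (Nat.cast_nonneg _) hF2le (Nat.cast_nonneg _) hF1le
    hS2pos.le (hS2le.trans hlogn9) hS1pos.le (hS1le.trans hlogn9) hX2 hX1 hs10
  -- ### the bad set in `F_n'`
  have hFnpos : (0 : ℝ) < (reducedWords k n).card := by
    rw [card_reducedWords k hn1]
    have : 0 < 2 * k * (2 * k - 1) ^ (n - 1) :=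
      Nat.mul_pos (by omega) (Nat.pow_pos (by omega))
    exact_mod_cast this
  -- normalise the decidability instances of the filters coming from `transfer_to_commutatorWords`
  have hinst1 : ∀ inst : DecidablePred fun w : Fin n → Fin k × Bool => ¬ GOOD w,
      @Finset.filter _ (fun w => ¬ GOOD w) inst (reducedWords k n) =
        (reducedWords k n).filter fun w => ¬ GOOD w :=
    fun inst => Finset.filter_congr_decidable _ _ _
  have hinst2 : ∀ inst : DecidablePred fun w : Fin n → Fin k × Bool => ¬ GOOD w,
      @Finset.filter _ (fun w => ¬ GOOD w) inst (commutatorWords k n) =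
        (commutatorWords k n).filter fun w => ¬ GOOD w :=
    fun inst => Finset.filter_congr_decidable _ _ _
  have h1 := htr heven (fun w => ¬ GOOD w)
  rw [hinst1, hinst2] at h1
  rw [hinst1] at hbad
  have h2 : ((((reducedWords k n).filter fun w => ¬ GOOD w).card : ℕ) : ℝ) ≤
      (F2 * (2 * (S2 : ℝ) * Real.exp (-(η ^ 2 * ((T02 : ℝ) * pm2) / 4))) +
        F1 * (2 * (S1 : ℝ) * Real.exp (-(η ^ 2 * ((T01 : ℝ) * pm1) / 4)))) *
        ((reducedWords k n).card : ℝ) := by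
    convert hbad using 3
    ext w
    simp only [Finset.mem_filter]
  have h3 : ((((commutatorWords k n).filter fun w => ¬ GOOD w).card : ℕ) : ℝ) *
      (reducedWords k n).card ≤
      2 * ((n : ℝ) + 1) ^ k * ((F2 * (2 * (S2 : ℝ) * Real.exp (-(η ^ 2 * ((T02 : ℝ) * pm2) / 4))) +
        F1 * (2 * (S1 : ℝ) * Real.exp (-(η ^ 2 * ((T01 : ℝ) * pm1) / 4)))) *
        ((reducedWords k n).card : ℝ)) * ((commutatorWords k n).card : ℝ) := by
    refine h1.trans ?_
    apply mul_le_mul_of_nonneg_right _ (Nat.cast_nonneg _)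
    exact mul_le_mul_of_nonneg_left h2 (by positivity)
  have e3 : 2 * ((n : ℝ) + 1) ^ k * ((F2 * (2 * (S2 : ℝ) * Real.exp (-(η ^ 2 * ((T02 : ℝ) * pm2) / 4))) +
      F1 * (2 * (S1 : ℝ) * Real.exp (-(η ^ 2 * ((T01 : ℝ) * pm1) / 4)))) * ((reducedWords k n).card : ℝ)) *
      ((commutatorWords k n).card : ℝ) =
      (2 * ((n : ℝ) + 1) ^ k * (F2 * (2 * (S2 : ℝ) * Real.exp (-(η ^ 2 * ((T02 : ℝ) * pm2) / 4))) +
        F1 * (2 * (S1 : ℝ) * Real.exp (-(η ^ 2 * ((T01 : ℝ) * pm1) / 4)))) *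
        ((commutatorWords k n).card : ℝ)) * ((reducedWords k n).card : ℝ) := by ring
  rw [e3] at h3
  have h4 := le_of_mul_le_mul_right h3 hFnpos
  have hbadC := h4.trans (mul_le_mul_of_nonneg_right hprob (Nat.cast_nonneg _))
  -- ### the means and the accuracy of the thresholds
  set A : ℝ := (n : ℝ) / (2 * k * q ^ (2 * (ℓ + 1) + 1)) with hAdef
  set B : ℝ := (n : ℝ) / (2 * k * q ^ ((ℓ + 1) + 1)) with hBdef
  set r : ℝ := (2 * k + 1) / q ^ ((ℓ + 1) + 2) with hrdef
  have hApos : 0 < A := by positivity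
  have hBpos : 0 < B := by positivity
  have hr0 : 0 ≤ r := by positivity
  have hm2 := subword_means (S := ((S2 : ℕ) : ℝ)) (g := ℓ + 1)
    (e := (ℓ + 1) + 1 + (2 * (ℓ + 1) + 1 + 1)) hnR hk0 hqpos (by omega)
  have e2 : (ℓ + 1) + 1 + (2 * (ℓ + 1) + 1 + 1) - ((ℓ + 1) + 2) = 2 * (ℓ + 1) + 1 := by omega
  rw [e2] at hm2
  have hm1 := subword_means (S := ((S1 : ℕ) : ℝ)) (g := ℓ + 1)
    (e := (ℓ + 1) + 1 + ((ℓ + 1) + 1 + 1)) hnR hk0 hqpos (by omega)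
  have e1 : (ℓ + 1) + 1 + ((ℓ + 1) + 1 + 1) - ((ℓ + 1) + 2) = (ℓ + 1) + 1 := by omega
  rw [e1] at hm1
  have hX2 : (n : ℝ) * pp2 = (1 + r) * A := by rw [hpp2]; exact hm2.1
  have hY2 : ((n : ℝ) - 2 * ((S2 : ℕ) : ℝ)) * pm2 = (1 - 2 * ((S2 : ℕ) : ℝ) / n) * ((1 - r) * A) := by
    rw [hpm2]; exact hm2.2
  have hX1 : (n : ℝ) * pp1 = (1 + r) * B := by rw [hpp1]; exact hm1.1
  have hY1 : ((n : ℝ) - 2 * ((S1 : ℕ) : ℝ)) * pm1 = (1 - 2 * ((S1 : ℕ) : ℝ) / n) * ((1 - r) * B) := by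
    rw [hpm1]; exact hm1.2
  have hs2le1 : 2 * ((S2 : ℕ) : ℝ) / n ≤ 1 := by
    rw [div_le_one hnR]
    have : ((2 * S2 : ℕ) : ℝ) ≤ n := by exact_mod_cast (show 2 * S2 ≤ n by omega)
    push_cast at this
    exact this
  have hs12 : 2 * ((S1 : ℕ) : ℝ) / n ≤ 2 * ((S2 : ℕ) : ℝ) / n := by
    apply div_le_div_of_nonneg_right _ hnR.le
    have : ((S1 : ℕ) : ℝ) ≤ S2 := by exact_mod_cast (show S1 ≤ S2 by omega)
    linarith
  have hacc := accuracy_bounds (η := η) (r := r) (s2 := 2 * ((S2 : ℕ) : ℝ) / n)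
    (s1 := 2 * ((S1 : ℕ) : ℝ) / n) (hh := (ℓ : ℝ) + 1) hApos hBpos hη0 hη1 hr0 (by positivity)
    hs2le1 (by positivity) hs12 (by positivity) hX2 hY2 hX1 hY1
  set AmaxN : ℕ := ⌊(1 + η) * ((n : ℝ) * pp2)⌋₊ with hAmaxN
  set AminN : ℕ := ⌈(1 - η) * (((n : ℝ) - 2 * ((S2 : ℕ) : ℝ)) * pm2)⌉₊ with hAminN
  set BmaxN : ℕ := ⌊(1 + η) * ((n : ℝ) * pp1)⌋₊ with hBmaxN
  set BminN : ℕ := ⌈(1 - η) * (((n : ℝ) - 2 * ((S1 : ℕ) : ℝ)) * pm1)⌉₊ with hBminN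
  set η₁ : ℝ := η + 2 * r + 2 * ((S2 : ℕ) : ℝ) / n + ((ℓ : ℝ) + 1) / B with hη₁
  obtain ⟨hAmax, hAmin, hBmax, hBmin, hAm1, hBm1⟩ := hacc
  -- `η₁` is small
  have hrle : r ≤ 3 * (n : ℝ) ^ (-(1 / 2 - θ)) := by
    rw [hrdef]
    have e : q ^ ((ℓ + 1) + 2) = q * q ^ (h + 1) := by rw [hℓ]; ring
    rw [e, div_le_iff₀ (by positivity)]
    have h1 : (2 * (k : ℝ) + 1) ≤ 3 * q := by rw [hqdef]; linarith
    have h2 : 3 * q = 3 * (n : ℝ) ^ (-(1 / 2 - θ)) * (q * (n : ℝ) ^ (1 / 2 - θ)) := by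
      rw [Real.rpow_neg hnR.le]
      field_simp
    calc (2 * (k : ℝ) + 1) ≤ 3 * q := h1
      _ = 3 * (n : ℝ) ^ (-(1 / 2 - θ)) * (q * (n : ℝ) ^ (1 / 2 - θ)) := h2
      _ ≤ 3 * (n : ℝ) ^ (-(1 / 2 - θ)) * (q * q ^ (h + 1)) := by
          apply mul_le_mul_of_nonneg_left _ (by positivity)
          exact mul_le_mul_of_nonneg_left hnL' hqpos.le
  have hs2le : 2 * ((S2 : ℕ) : ℝ) / n ≤ 18 * Real.log n / n := by
    apply div_le_div_of_nonneg_right _ hnR.le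
    linarith [hS2le]
  have hhBle : ((ℓ : ℝ) + 1) / B ≤ 6 * k * (2 * k - 1) * Real.log n * (n : ℝ) ^ (1 / 2 - θ) / n := by
    rw [hBdef, hhR]
    have e : (h : ℝ) / ((n : ℝ) / (2 * k * q ^ ((ℓ + 1) + 1))) = (h : ℝ) * (2 * k * q ^ (h + 1)) / n := by
      rw [hℓ]; field_simp
    rw [e]
    apply div_le_div_of_nonneg_right _ hnR.le
    have h1 : (h : ℝ) ≤ 3 * Real.log n := by linarith
    calc (h : ℝ) * (2 * k * q ^ (h + 1)) ≤ (3 * Real.log n) * (2 * k * (q * (n : ℝ) ^ (1 / 2 - θ))) := by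
          apply mul_le_mul h1 _ (by positivity) (by positivity)
          exact mul_le_mul_of_nonneg_left hqh1 (by positivity)
      _ = 6 * k * (2 * k - 1) * Real.log n * (n : ℝ) ^ (1 / 2 - θ) := by rw [hqdef]; ring
  have hη₁small : η₁ * Real.log n ≤ ε₀ / 9 := by
    rw [hη₁]; exact eta1_small hn1 hk2 hθpos hθ8 hε₀pos hlog1 hηdef hrle hs2le hhBle hs1 hs2 hs3
  have hη₁0 : 0 ≤ η₁ := by rw [hη₁]; positivity
  have hη₁le : η₁ ≤ 1 / 9 := by
    have : η₁ ≤ η₁ * Real.log n := le_mul_of_one_le_right hη₁0 hlog1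
    linarith [hε₀1]
  have hη₁half : η₁ ≤ 1 / 2 := by linarith
  -- `A ≥ 2`, `B ≥ A`
  have hAge2 : 2 ≤ A := by
    rw [hAdef, le_div_iff₀ (by positivity)]
    have e : q ^ (2 * (ℓ + 1) + 1) = q ^ (2 * h + 1) := by rw [hℓ]
    rw [e]
    have h1 : (n : ℝ) ^ (1 - 2 * θ) = n * (n : ℝ) ^ (-(2 * θ)) := by
      rw [show (1 : ℝ) - 2 * θ = 1 + -(2 * θ) by ring, Real.rpow_add hnR, Real.rpow_one]
    have h2 : (n : ℝ) ^ (-(2 * θ)) * (4 * k * q) ≤ 1 := by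
      have := mul_le_mul_of_nonneg_right hs6 (by positivity : (0 : ℝ) ≤ 4 * k * q)
      rwa [one_div, inv_mul_cancel₀ (by positivity)] at this
    calc 2 * (2 * (k : ℝ) * q ^ (2 * h + 1)) ≤ 2 * (2 * k * (q * (n : ℝ) ^ (1 - 2 * θ))) := by
          apply mul_le_mul_of_nonneg_left _ (by norm_num)
          exact mul_le_mul_of_nonneg_left hq2h1 (by positivity)
      _ = n * ((n : ℝ) ^ (-(2 * θ)) * (4 * k * q)) := by rw [h1]; ring
      _ ≤ n * 1 := mul_le_mul_of_nonneg_left h2 hnR.le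
      _ = n := mul_one _
  have hBA : A ≤ B := by
    rw [hAdef, hBdef]
    apply div_le_div_of_nonneg_left hnR.le (by positivity)
    apply mul_le_mul_of_nonneg_left _ (by positivity)
    exact pow_le_pow_right₀ hq1 (by omega)
  -- the threshold
  have hqn : Real.log q / Real.log n ≤ θ := by
    rw [div_le_iff₀ hlogpos]
    rw [div_le_iff₀ hθpos] at hlogq
    linarith
  have hhge' : (1 / 2 - θ) * Real.log n / Real.log q - 1 ≤ (ℓ : ℝ) + 1 := by rw [hhR]; exact hhge
  have hthr := threshold_sharp_le hlq hlogpos hθpos hθ8 hθε hε₀pos hqn hhge'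
  have htail : (2 * ((ℓ : ℝ) + 1) + 3) * Real.log n / n ≤ ε₀ / 3 := by
    rw [hhR]
    have hlog2 := log_sq_mul_rpow_neg_le (c := 1) one_pos hn1
    have h1 : (2 * (h : ℝ) + 3) * Real.log n / n ≤ 9 * ((Real.log n) ^ 2 * (n : ℝ) ^ (-(1 : ℝ))) := by
      rw [Real.rpow_neg hnR.le, Real.rpow_one, div_eq_mul_inv]
      have h9 : (2 * (h : ℝ) + 3) ≤ 9 * Real.log n := by linarith
      have h0 : 0 ≤ Real.log n * (n : ℝ)⁻¹ := by positivity
      calc (2 * (h : ℝ) + 3) * Real.log n * (n : ℝ)⁻¹ = (2 * (h : ℝ) + 3) * (Real.log n * (n : ℝ)⁻¹) := by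
            ring
        _ ≤ (9 * Real.log n) * (Real.log n * (n : ℝ)⁻¹) := mul_le_mul_of_nonneg_right h9 h0
        _ = 9 * ((Real.log n) ^ 2 * (n : ℝ)⁻¹) := by ring
    have h2 : 9 * ((Real.log n) ^ 2 * (n : ℝ) ^ (-(1 : ℝ))) ≤ 9 * ((16 / 1 ^ 2) * (ε₀ / 10368)) := by
      apply mul_le_mul_of_nonneg_left _ (by norm_num)
      refine hlog2.trans ?_
      apply mul_le_mul_of_nonneg_left _ (by norm_num)
      simpa using hs3
    linarith
  -- ### the inclusion
  have hincl : ((commutatorWords k n).filter fun w =>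
      Real.log (2 * k - 1) / 6 + ε <
        stableCommutatorLength (FreeGroup.mk (List.ofFn w)) * Real.log n / n) ⊆
      (commutatorWords k n).filter fun w => ¬ GOOD w := by
    intro w hw
    rw [Finset.mem_filter] at hw ⊢
    refine ⟨hw.1, fun hgood => ?_⟩
    have hw2 := hw.2
    simp only [hGOOD] at hgood
    obtain ⟨hgA, hgB⟩ := hgood
    have hE2 := scl_le_of_subwordCounts hk w hw.1 ℓ (by omega) AminN AmaxN BminN BmaxN hgA hgB
    -- the natural-number atoms
    set sclw : ℝ := stableCommutatorLength (FreeGroup.mk (List.ofFn w)) with hsclw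
    set qqN : ℕ := (2 * k - 2) * (2 * k - 2) with hqqN
    set nN : ℕ := n - ℓ - 1 - 1 + 1 - (2 * (ℓ + 1) + 3) with hnN
    set BHN : ℕ := BminN - (ℓ + 1) with hBHN
    set DN : ℕ := AmaxN - AminN with hDN
    have hqqpos : 0 < qqN := Nat.mul_pos (by omega) (by omega)
    have hqq1 : (1 : ℝ) ≤ (qqN : ℝ) := by exact_mod_cast hqqpos
    have hnN' : ((nN : ℕ) : ℝ) = n - 3 * ((ℓ : ℝ) + 1) - 3 := by
      rw [hnN, show n - ℓ - 1 - 1 + 1 - (2 * (ℓ + 1) + 3) = n - (3 * ℓ + 6) by omega,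
        Nat.cast_sub (by omega)]
      push_cast
      ring
    push_cast [Nat.cast_sub (show 1 ≤ 3 * (ℓ + 1) by omega)] at hE2
    have hmain : 4 * (3 * ((ℓ : ℝ) + 1) * (((qqN : ℝ) * (BmaxN : ℝ)) * ((qqN : ℝ) * (AmaxN : ℝ)))) * sclw +
        (3 * ((ℓ : ℝ) + 1) - 1) * ((nN : ℝ) * ((qqN : ℝ) * (BHN : ℝ)) * ((qqN : ℝ) * (AminN : ℝ))) ≤
        (3 * ((ℓ : ℝ) + 1) * (((qqN : ℝ) * (BmaxN : ℝ)) * ((qqN : ℝ) * (AmaxN : ℝ)))) * n + 2 +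
          (((ℓ : ℝ) + 1) + 1) * (3 * (qqN : ℝ) * ((DN : ℝ) * ((nN : ℝ) * ((qqN : ℝ) * (BmaxN : ℝ))) +
            (AmaxN : ℝ) * (2 * ((ℓ : ℝ) + 1) * ((qqN : ℝ) * (BmaxN : ℝ))))) := by
      linarith [hE2]
    -- hypotheses of `scl_ratio_le`
    have hA2' : A ≤ 2 * (AmaxN : ℝ) := by linarith
    have hA1' : (1 : ℝ) ≤ (AmaxN : ℝ) := by linarith
    have hB1' : (1 : ℝ) ≤ (BmaxN : ℝ) := by linarith
    have hD' : ((DN : ℕ) : ℝ) ≤ 2 * η₁ * A := by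
      rcases le_total AminN AmaxN with hle | hle
      · rw [hDN, Nat.cast_sub hle]; linarith
      · rw [hDN, Nat.sub_eq_zero_of_le hle]; push_cast; positivity
    have hBmin' : (1 - η₁) * B ≤ ((BHN : ℕ) : ℝ) := by
      rcases le_total (ℓ + 1) BminN with hle | hle
      · rw [hBHN, Nat.cast_sub hle]; push_cast; linarith
      · rw [hBHN, Nat.sub_eq_zero_of_le hle]
        have : ((BminN : ℕ) : ℝ) ≤ ((ℓ + 1 : ℕ) : ℝ) := by exact_mod_cast hle
        push_cast at this ⊢
        linarith
    have hn3' : 3 * ((ℓ : ℝ) + 1) + 3 ≤ n := by rw [hhR]; linarith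
    have hn'1 : (n : ℝ) - 3 * ((ℓ : ℝ) + 1) - 3 ≤ (nN : ℝ) := hnN'.symm.le
    have hn'2 : ((nN : ℕ) : ℝ) ≤ n := by rw [hnN']; linarith [hn3']
    have hh1r : (1 : ℝ) ≤ (ℓ : ℝ) + 1 := by
      have : (0 : ℝ) ≤ ℓ := Nat.cast_nonneg _
      linarith
    have hs := scl_ratio_le hh1r hqq1 hApos hBpos hη₁0 hη₁half hAmax hAmin hA2' hA1'
      (Nat.cast_nonneg _) hD' hBmax hBmin' hB1' hn3' hn'1 hn'2 hmain
    -- conclude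
    have hsclnn : 0 ≤ sclw := stableCommutatorLength_nonneg _
    have hfin : sclw * Real.log n / n ≤ Real.log q / 6 + ε₀ := by
      have h1 : sclw * Real.log n / n ≤
          ((n : ℝ) / (12 * ((ℓ : ℝ) + 1)) + 3 * η₁ * n + 2 * ((ℓ : ℝ) + 1) + 3) * Real.log n / n := by
        apply div_le_div_of_nonneg_right _ hnR.le
        exact mul_le_mul_of_nonneg_right hs hlogpos.le
      have e : ((n : ℝ) / (12 * ((ℓ : ℝ) + 1)) + 3 * η₁ * n + 2 * ((ℓ : ℝ) + 1) + 3) * Real.log n / n =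
          Real.log n / (12 * ((ℓ : ℝ) + 1)) + 3 * (η₁ * Real.log n) +
            (2 * ((ℓ : ℝ) + 1) + 3) * Real.log n / n := by
        field_simp
        ring
      rw [e] at h1
      linarith [hthr, hη₁small, htail]
    rw [← hqdef] at hw2
    linarith [hw2, hfin, hε₀ε]
  -- ### conclusion
  calc ((((commutatorWords k n).filter fun w =>
          Real.log (2 * k - 1) / 6 + ε <
            stableCommutatorLength (FreeGroup.mk (List.ofFn w)) * Real.log n / n).card : ℕ) : ℝ)
      ≤ ((((commutatorWords k n).filter fun w => ¬ GOOD w).card : ℕ) : ℝ) := by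
        exact_mod_cast Finset.card_le_card hincl
    _ ≤ (n : ℝ) ^ (-C) * ((commutatorWords k n).card : ℝ) := hbadC
    _ = 1 * (n : ℝ) ^ (-C) * ((commutatorWords k n).card : ℝ) := by ring

end Final

end Literature.GroupTheory.CombinatorialGroupTheory

end
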